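import Mathlib.LinearAlgebra.FiniteDimensional.Lemmas
import Mathlib.LinearAlgebra.Matrix.BilinearForm
import Mathlib.LinearAlgebra.Matrix.ToLin
import Mathlib.Tactic.Module
import Mathlib.Tactic.LinearCombination
import Mathlib.Tactic.Positivity
import HarnessLib

/-!
# Ring 2 · AbelianAll (seat `ab-weil-2`, gen 2) — the Lagrangian of Lemma R1: a rank-2 module over a definite quaternion
order with a compatible alternating form contains a `k`-stable isotropic 4-space for some quadratic `k` in the order

HONEST FRAMING (sub-cell `pub-hodge-ring2-ab-*`, verbatim): research route, not a corollary; conditional on HC_CM plus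
one named minimal statement. (Cell `pub-hodge-ring2`, verbatim: research route conditional on HC_CM; not a corollary;
Q11.4-sentence-2 already refuted in dim ≥ 3.) THIS FILE is pure linear algebra over `ℚ` (no geometry, no named fact, no
hypothesis of the cell): the second of the three files making LEMMA R1 of seat `ab-weil-2` a kernel theorem (see
`Theorems/Ring2AbelianAllQuaternionPolarization` for the plan and `…TypeIIIFourfoldsKernel` for the assembly).

THE STATEMENT (`exists_isotropic_stable_frame`, abstract; `exists_isotropic_stable_coords`, in coordinates). `V` a
finite-dimensional `ℚ`-space, `dim V > 4`; `p, q ∈ End(V)`, `p² = -d`, `q² = -e` (`d, e > 0`), `pq = -qp` (a module over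
the definite quaternion algebra `(-d, -e)_ℚ`); `B` an ALTERNATING form with `p`, `q` skew (`B(px, y) = -B(x, py)` etc.;
for `V = H¹(X, ℚ)` and `B` the polarization pairing: "the Rosati involution is quaternion conjugation",
cf. `…QuaternionPolarization`). Then for some integers `(a, b, c) ≠ 0` — a pure `θ = a·p + b·q + c·pq`, `θ² = -N`,
`N = a²d + b²e + c²de` — four `ℚ`-independent vectors span a `θ`-STABLE subspace on which `B ≡ 0` (for `dim V = 8`,
`B` non-degenerate: a `ℚ(θ)`-stable Lagrangian — hyperbolicity of `(X, ℚ(θ))`, van Geemen LNM 1594, 5.2–5.4).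

THE PROOF (= steps (3)–(5) of Lemma R1 in `Theorems/Ring2AbelianAllTypeIIIFourfolds`, without the quaternion-valued
form `T`). Fix `e₁ ≠ 0`, its quaternion line `U = ⟨e₁, pe₁, qe₁, pqe₁⟩` and `U^⊥ = {y : B(U, y) = 0}` (`dim U^⊥ > 0`;
`p`-, `q`-stable). CASE A — `B(e₁, pe₁) = B(e₁, qe₁) = B(e₁, pqe₁) = 0`: `U` is isotropic and `p`-stable; `θ = p`,
`w = (e₁, pe₁, qe₁, pqe₁)`, independent by the NORM TRICK (apply `a - bp - cq - c'pq` to a relation: the result is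
`(a² + b²d + c²e + c'²de) e₁ = 0`). CASE B — otherwise: pick `0 ≠ e₂ ∈ U^⊥` and `(a, b, c) ≠ 0` killing the two linear
forms `(a, b, c) ↦ B(eᵢ, (ap + bq + cpq)eᵢ)` on `ℚ³`; with `θ = ap + bq + cpq` the frame `(e₁, θe₁, e₂, θe₂)` is isotropic,
`θ`-stable (`θ² = -N`) and independent (a relation puts `αe₁ + βθe₁ ∈ U^⊥`; if `(α, β) ≠ 0` the norm trick gives
`e₁ ∈ U^⊥`, i.e. CASE A; then `γe₂ + δθe₂ = 0` forces `γ = δ = 0`).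

## References

* [vanGeemen1994HodgeAV] B. van Geemen, LNM 1594 (1994), Lemma 5.2 (1)–(3), 5.3–5.4 (hyperbolic = Witt index `n`).
* [MumfordAV1970] D. Mumford, Abelian Varieties (1970), §20–§21 (Rosati involution; type III: standard involution).
-/

set_option linter.dupNamespace false

noncomputable section

namespace Summit.HodgeConjecture.HodgeConjecture.Ring2.AbelianAll

namespace QuaternionFrame

open Module

variable {V : Type*} [AddCommGroup V] [Module ℚ V]

/-! ## §1 The norm trick (injectivity of the quaternion action on a non-zero vector) -/

/-- **Two-term norm trick**: if `θ² = -N` then `α(αx + βθx) - βθ(αx + βθx) = (α² + β²N)·x`. [folklore] -/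
theorem norm_trick_two (t : Module.End ℚ V) {N : ℚ} (ht : ∀ x, t (t x) = -(N • x)) (α β : ℚ) (x : V) :
    α • (α • x + β • t x) - β • t (α • x + β • t x) = (α ^ 2 + β ^ 2 * N) • x := by
  simp only [map_add, map_smul, ht, smul_neg, smul_add, smul_smul]
  module

/-- Hence `αx + βθx = 0`, `x ≠ 0`, `N > 0` force `α = β = 0` (`θ` has no rational eigenvalue). [folklore] -/
theorem eq_zero_of_two_term (t : Module.End ℚ V) {N : ℚ} (ht : ∀ x, t (t x) = -(N • x)) (hN : 0 < N)
    {x : V} (hx : x ≠ 0) {α β : ℚ} (h : α • x + β • t x = 0) : α = 0 ∧ β = 0 := by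
  have h1 := norm_trick_two t ht α β x
  rw [h, map_zero, smul_zero, smul_zero, sub_zero] at h1
  have h2 : α ^ 2 + β ^ 2 * N = 0 := by_contra fun hne => hx ((smul_eq_zero.1 h1.symm).resolve_left hne)
  have h3 : α ^ 2 = 0 ∧ β ^ 2 * N = 0 := by
    constructor <;> nlinarith [sq_nonneg α, sq_nonneg β, mul_nonneg (sq_nonneg β) hN.le]
  exact ⟨pow_eq_zero_iff two_ne_zero |>.1 h3.1,
    pow_eq_zero_iff two_ne_zero |>.1 ((mul_eq_zero.1 h3.2).resolve_right hN.ne')⟩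

/-- **Four-term norm trick**: for the quaternion action (`p² = -d`, `q² = -e`, `qp = -pq`, `d, e > 0`) a relation
`ax + bpx + cqx + c'pqx = 0` with `x ≠ 0` forces `a = b = c = c' = 0` (apply `a - bp - cq - c'pq`: the result is
`(a² + b²d + c²e + c'²de)·x`). [folklore] -/
theorem eq_zero_of_four_term (p q : Module.End ℚ V) {d e : ℚ} (hd : 0 < d) (he : 0 < e)
    (hp : ∀ x, p (p x) = -(d • x)) (hq : ∀ x, q (q x) = -(e • x)) (hqp : ∀ x, q (p x) = -(p (q x)))
    {x : V} (hx : x ≠ 0) {a b c c' : ℚ} (h : a • x + b • p x + c • q x + c' • p (q x) = 0) :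
    a = 0 ∧ b = 0 ∧ c = 0 ∧ c' = 0 := by
  have key : a • (a • x + b • p x + c • q x + c' • p (q x)) - b • p (a • x + b • p x + c • q x + c' • p (q x))
      - c • q (a • x + b • p x + c • q x + c' • p (q x)) - c' • p (q (a • x + b • p x + c • q x + c' • p (q x)))
      = (a ^ 2 + b ^ 2 * d + c ^ 2 * e + c' ^ 2 * (d * e)) • x := by
    simp only [map_add, map_smul, hp, hq, hqp, map_neg, smul_neg, neg_neg, smul_add, smul_smul]
    module
  rw [h, map_zero, map_zero, map_zero, smul_zero, smul_zero, smul_zero, smul_zero, sub_zero, sub_zero, sub_zero] at key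
  have h2 : a ^ 2 + b ^ 2 * d + c ^ 2 * e + c' ^ 2 * (d * e) = 0 :=
    by_contra fun hne => hx ((smul_eq_zero.1 key.symm).resolve_left hne)
  have hde : 0 < d * e := mul_pos hd he
  have h4 : a ^ 2 = 0 ∧ b ^ 2 * d = 0 ∧ c ^ 2 * e = 0 ∧ c' ^ 2 * (d * e) = 0 := by
    refine ⟨?_, ?_, ?_, ?_⟩ <;>
      nlinarith [sq_nonneg a, sq_nonneg b, sq_nonneg c, sq_nonneg c', mul_nonneg (sq_nonneg b) hd.le,
        mul_nonneg (sq_nonneg c) he.le, mul_nonneg (sq_nonneg c') hde.le]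
  obtain ⟨ha, hb, hc, hc'⟩ := h4
  refine ⟨pow_eq_zero_iff two_ne_zero |>.1 ha, ?_, ?_, ?_⟩
  · exact pow_eq_zero_iff two_ne_zero |>.1 ((mul_eq_zero.1 hb).resolve_right hd.ne')
  · exact pow_eq_zero_iff two_ne_zero |>.1 ((mul_eq_zero.1 hc).resolve_right he.ne')
  · exact pow_eq_zero_iff two_ne_zero |>.1 ((mul_eq_zero.1 hc').resolve_right hde.ne')

/-! ## §2 Case A: the quaternion line of `e₁` is isotropic -/

/-- **Case A.** If `B(e₁, pe₁) = B(e₁, qe₁) = B(e₁, pqe₁) = 0` then `(e₁, pe₁, qe₁, pqe₁)` is an independent,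
`p`-stable, `B`-isotropic frame. [cite: vanGeemen1994HodgeAV, Lemma 5.2 (2)] -/
theorem caseA (p q : Module.End ℚ V) (B : LinearMap.BilinForm ℚ V) {d e : ℚ} (hd : 0 < d) (he : 0 < e)
    (hp : ∀ x, p (p x) = -(d • x)) (hq : ∀ x, q (q x) = -(e • x)) (hqp : ∀ x, q (p x) = -(p (q x)))
    (hBalt : ∀ x, B x x = 0) (hBp : ∀ x y, B (p x) y = -B x (p y)) (hBq : ∀ x y, B (q x) y = -B x (q y))
    {e₁ : V} (he₁ : e₁ ≠ 0) (h1 : B e₁ (p e₁) = 0) (h2 : B e₁ (q e₁) = 0) (h3 : B e₁ (p (q e₁)) = 0) :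
    ∃ w : Fin 4 → V, LinearIndependent ℚ w ∧ (∀ k, ∃ coef : Fin 4 → ℚ, p (w k) = ∑ l, coef l • w l) ∧
      ∀ k l, B (w k) (w l) = 0 := by
  refine ⟨![e₁, p e₁, q e₁, p (q e₁)], ?_, ?_, ?_⟩
  · rw [Fintype.linearIndependent_iff]
    intro g hg
    rw [Fin.sum_univ_four] at hg
    simp only [Matrix.cons_val_zero, Matrix.cons_val_one, Matrix.cons_val] at hg
    obtain ⟨h0, h1', h2', h3'⟩ := eq_zero_of_four_term p q hd he hp hq hqp he₁ hg
    intro i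
    fin_cases i <;> assumption
  · intro k
    fin_cases k <;> [exact ⟨![0, 1, 0, 0], by simp [Fin.sum_univ_four]⟩;
      exact ⟨![-d, 0, 0, 0], by simp [Fin.sum_univ_four, hp]⟩; exact ⟨![0, 0, 0, 1], by simp [Fin.sum_univ_four]⟩;
      exact ⟨![0, 0, -d, 0], by simp [Fin.sum_univ_four, hp]⟩]
  · intro k l
    fin_cases k <;> fin_cases l <;>
      simp [hBp, hBq, hp, hq, hqp, map_neg, map_smul, hBalt, h1, h2, h3]

/-! ## §3 Case B: `e₁` is not in `U^⊥`, some `0 ≠ e₂` is -/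

/-- **Case B.** Let `θ² = -N` (`N > 0`), `B(θx, y) = -B(x, θy)`, and `W ⊆ V` a `θ`-stable subspace, `B`-orthogonal to
`e₁`, with `e₁ ∉ W`, `0 ≠ e₂ ∈ W`, and `B(e₁, θe₁) = B(e₂, θe₂) = 0`. Then `(e₁, θe₁, e₂, θe₂)` is an independent,
`θ`-stable, `B`-isotropic frame. [cite: vanGeemen1994HodgeAV, Lemma 5.2 (2)] -/
theorem caseB (t : Module.End ℚ V) (B : LinearMap.BilinForm ℚ V) {N : ℚ} (hN : 0 < N)
    (ht : ∀ x, t (t x) = -(N • x)) (hBalt : ∀ x, B x x = 0) (hBt : ∀ x y, B (t x) y = -B x (t y))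
    (W : Submodule ℚ V) (hWt : ∀ y ∈ W, t y ∈ W) {e₁ e₂ : V} (hWe : ∀ y ∈ W, B e₁ y = 0)
    (he₁ : e₁ ∉ W) (he₂W : e₂ ∈ W) (he₂ : e₂ ≠ 0)
    (hA1 : B e₁ (t e₁) = 0) (hA2 : B e₂ (t e₂) = 0) :
    ∃ w : Fin 4 → V, LinearIndependent ℚ w ∧ (∀ k, ∃ coef : Fin 4 → ℚ, t (w k) = ∑ l, coef l • w l) ∧
      ∀ k l, B (w k) (w l) = 0 := by
  have hBanti : ∀ x y, B x y = -B y x := fun x y => by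
    have h := hBalt (x + y)
    simp only [map_add, LinearMap.add_apply, hBalt, zero_add, add_zero] at h
    linear_combination h
  have h12 : B e₁ e₂ = 0 := hWe e₂ he₂W
  have h21 : B e₂ e₁ = 0 := by rw [hBanti, h12, neg_zero]
  have h1t2 : B e₁ (t e₂) = 0 := hWe _ (hWt e₂ he₂W)
  have h2t1 : B e₂ (t e₁) = 0 := by rw [hBanti, hBt, h1t2, neg_zero, neg_zero]
  refine ⟨![e₁, t e₁, e₂, t e₂], ?_, ?_, ?_⟩
  · rw [Fintype.linearIndependent_iff]
    intro g hg
    rw [Fin.sum_univ_four] at hg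
    simp only [Matrix.cons_val_zero, Matrix.cons_val_one, Matrix.cons_val] at hg
    -- `x := g₀ e₁ + g₁ θe₁ = -(g₂ e₂ + g₃ θe₂) ∈ W`
    have hxW : g 0 • e₁ + g 1 • t e₁ ∈ W := by
      have hx : g 0 • e₁ + g 1 • t e₁ = -(g 2 • e₂ + g 3 • t e₂) := by
        rw [eq_neg_iff_add_eq_zero, ← hg]; abel
      rw [hx]
      exact W.neg_mem (W.add_mem (W.smul_mem _ he₂W) (W.smul_mem _ (hWt e₂ he₂W)))
    have h01 : g 0 = 0 ∧ g 1 = 0 := by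
      by_contra hne
      have hz : (g 0 ^ 2 + g 1 ^ 2 * N) • e₁ ∈ W := by
        rw [← norm_trick_two t ht (g 0) (g 1) e₁]
        exact W.sub_mem (W.smul_mem _ hxW) (W.smul_mem _ (hWt _ hxW))
      have hpos : g 0 ^ 2 + g 1 ^ 2 * N ≠ 0 := by
        intro h0
        have h3 : g 0 ^ 2 = 0 ∧ g 1 ^ 2 * N = 0 := by
          constructor <;> nlinarith [sq_nonneg (g 0), sq_nonneg (g 1), mul_nonneg (sq_nonneg (g 1)) hN.le]
        exact hne ⟨pow_eq_zero_iff two_ne_zero |>.1 h3.1,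
          pow_eq_zero_iff two_ne_zero |>.1 ((mul_eq_zero.1 h3.2).resolve_right hN.ne')⟩
      exact he₁ ((W.smul_mem_iff hpos).1 hz)
    obtain ⟨hg0, hg1⟩ := h01
    rw [hg0, hg1, zero_smul, zero_smul, zero_add, zero_add] at hg
    obtain ⟨hg2, hg3⟩ := eq_zero_of_two_term t ht hN he₂ hg
    intro i
    fin_cases i <;> assumption
  · intro k
    fin_cases k <;> [exact ⟨![0, 1, 0, 0], by simp [Fin.sum_univ_four]⟩;
      exact ⟨![-N, 0, 0, 0], by simp [Fin.sum_univ_four, ht]⟩; exact ⟨![0, 0, 0, 1], by simp [Fin.sum_univ_four]⟩;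
      exact ⟨![0, 0, -N, 0], by simp [Fin.sum_univ_four, ht]⟩]
  · have h11 : B e₁ e₁ = 0 := hBalt e₁
    have h22 : B e₂ e₂ = 0 := hBalt e₂
    intro k l
    fin_cases k <;> fin_cases l <;>
      simp [hBt, ht, map_neg, map_smul, h11, h22, hA1, hA2, h12, h21, h1t2, h2t1]

/-! ## §4 The frame theorem -/

/-- Clearing denominators of three rationals. [folklore] -/
theorem exists_int_mul_three (x y z : ℚ) :
    ∃ (n : ℕ) (a b c : ℤ), 0 < n ∧ (a : ℚ) = n * x ∧ (b : ℚ) = n * y ∧ (c : ℚ) = n * z := by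
  refine ⟨x.den * y.den * z.den, x.num * y.den * z.den, x.den * y.num * z.den, x.den * y.den * z.num,
    Nat.mul_pos (Nat.mul_pos x.den_pos y.den_pos) z.den_pos, ?_, ?_, ?_⟩
  · push_cast; rw [← Rat.mul_den_eq_num x]; ring
  · push_cast; rw [← Rat.mul_den_eq_num y]; ring
  · push_cast; rw [← Rat.mul_den_eq_num z]; ring

/-- **THE ISOTROPIC STABLE FRAME (Lemma R1, linear-algebra core).** `V` finite-dimensional over `ℚ` with
`4 < dim V`; `p² = -d`, `q² = -e`, `pq = -qp` (`d, e > 0`); `B` alternating with `p`, `q` skew. Then for some integers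
`(a, b, c) ≠ (0, 0, 0)` and `θ = a·p + b·q + c·pq` there are four `ℚ`-independent vectors spanning a `θ`-stable
subspace on which `B ≡ 0`. [cite: vanGeemen1994HodgeAV, Lemma 5.2 (2) and 5.4] [cite: MumfordAV1970, §21 Thm. 2] -/
theorem exists_isotropic_stable_frame [FiniteDimensional ℚ V] (hV : 4 < finrank ℚ V)
    (p q : Module.End ℚ V) (B : LinearMap.BilinForm ℚ V) {d e : ℚ} (hd : 0 < d) (he : 0 < e)
    (hp : ∀ x, p (p x) = -(d • x)) (hq : ∀ x, q (q x) = -(e • x)) (hqp : ∀ x, q (p x) = -(p (q x)))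
    (hBalt : ∀ x, B x x = 0) (hBp : ∀ x y, B (p x) y = -B x (p y)) (hBq : ∀ x y, B (q x) y = -B x (q y)) :
    ∃ a b c : ℤ, (a ≠ 0 ∨ b ≠ 0 ∨ c ≠ 0) ∧ ∃ w : Fin 4 → V, LinearIndependent ℚ w ∧
      (∀ k, ∃ coef : Fin 4 → ℚ, ((a : ℚ) • p + (b : ℚ) • q + (c : ℚ) • (p * q)) (w k) = ∑ l, coef l • w l) ∧
      ∀ k l, B (w k) (w l) = 0 := by
  -- a non-zero vector
  obtain ⟨e₁, he₁⟩ := (Module.finrank_pos_iff_exists_ne_zero (R := ℚ) (M := V)).1 (by omega)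
  have hBanti : ∀ x y, B x y = -B y x := fun x y => by
    have h := hBalt (x + y)
    simp only [map_add, LinearMap.add_apply, hBalt, zero_add, add_zero] at h
    linear_combination h
  have hBpq : ∀ x y, B (p (q x)) y = -B x (p (q y)) := fun x y => by
    rw [hBp, hBq, hqp, map_neg, neg_neg]
  by_cases hA : B e₁ (p e₁) = 0 ∧ B e₁ (q e₁) = 0 ∧ B e₁ (p (q e₁)) = 0
  · -- CASE A: `θ = p`
    obtain ⟨w, hw, hws, hwB⟩ := caseA p q B hd he hp hq hqp hBalt hBp hBq he₁ hA.1 hA.2.1 hA.2.2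
    refine ⟨1, 0, 0, Or.inl one_ne_zero, w, hw, fun k => ?_, hwB⟩
    obtain ⟨coef, hc⟩ := hws k
    exact ⟨coef, by simpa using hc⟩
  · -- CASE B. The orthogonal `W = U^⊥` of the quaternion line `U = ⟨e₁, pe₁, qe₁, pqe₁⟩`
    let g : Fin 4 → V := ![e₁, p e₁, q e₁, p (q e₁)]
    let Φ : V →ₗ[ℚ] (Fin 4 → ℚ) := LinearMap.pi fun i => B (g i)
    let W : Submodule ℚ V := LinearMap.ker Φ
    have hWmem : ∀ y, y ∈ W ↔ ∀ i, B (g i) y = 0 := fun y => by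
      simp only [W, Φ, LinearMap.mem_ker, LinearMap.pi_apply, funext_iff, Pi.zero_apply]
    have hg0 : g 0 = e₁ := rfl; have hg1 : g 1 = p e₁ := rfl
    have hg2 : g 2 = q e₁ := rfl; have hg3 : g 3 = p (q e₁) := rfl
    -- `W` is `p`- and `q`-stable
    have hWp : ∀ y ∈ W, p y ∈ W := fun y hy => by
      rw [hWmem] at hy ⊢
      have h0 := hy 0; have h1 := hy 1; have h2 := hy 2; have h3 := hy 3
      rw [hg0] at h0; rw [hg1] at h1; rw [hg2] at h2; rw [hg3] at h3
      intro i
      fin_cases i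
      · show B e₁ (p y) = 0; rw [← neg_eq_zero, ← hBp, h1]
      · show B (p e₁) (p y) = 0; rw [hBp, hp, map_neg, map_smul, h0, smul_zero, neg_zero, neg_zero]
      · show B (q e₁) (p y) = 0; rw [← neg_eq_zero, ← hBp, h3]
      · show B (p (q e₁)) (p y) = 0; rw [hBp, hp, map_neg, map_smul, h2, smul_zero, neg_zero, neg_zero]
    have hWq : ∀ y ∈ W, q y ∈ W := fun y hy => by
      rw [hWmem] at hy ⊢
      have h0 := hy 0; have h1 := hy 1; have h2 := hy 2; have h3 := hy 3
      rw [hg0] at h0; rw [hg1] at h1; rw [hg2] at h2; rw [hg3] at h3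
      intro i
      fin_cases i
      · show B e₁ (q y) = 0; rw [← neg_eq_zero, ← hBq, h2]
      · show B (p e₁) (q y) = 0; rw [← neg_eq_zero, ← hBq, hqp, map_neg, LinearMap.neg_apply, h3, neg_zero]
      · show B (q e₁) (q y) = 0; rw [hBq, hq, map_neg, map_smul, h0, smul_zero, neg_zero, neg_zero]
      · show B (p (q e₁)) (q y) = 0
        have h1' : B e₁ (p y) = 0 := by rw [← neg_eq_zero, ← hBp]; exact h1
        rw [hBpq, hq, map_neg, map_smul, map_neg, map_smul, h1', smul_zero, neg_zero, neg_zero]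
    have hWe : ∀ y ∈ W, B e₁ y = 0 := fun y hy => by rw [← hg0]; exact (hWmem y).1 hy 0
    have he₁W : e₁ ∉ W := by
      intro h
      rw [hWmem] at h
      have h1 := h 1; have h2 := h 2; have h3 := h 3
      rw [hg1] at h1; rw [hg2] at h2; rw [hg3] at h3
      apply hA
      refine ⟨?_, ?_, ?_⟩
      · rw [hBp] at h1; exact neg_eq_zero.1 h1
      · rw [hBq] at h2; exact neg_eq_zero.1 h2
      · rw [hBpq] at h3; exact neg_eq_zero.1 h3
    -- `W ≠ 0`: `dim (Fin 4 → ℚ) = 4 < dim V`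
    have hW : W ≠ ⊥ := LinearMap.ker_ne_bot_of_finrank_lt (by simpa using hV)
    obtain ⟨e₂, he₂W, he₂⟩ := Submodule.exists_mem_ne_zero_of_ne_bot hW
    -- `(a, b, c) ≠ 0` killing the two linear forms on `ℚ³`
    let M : Matrix (Fin 2) (Fin 3) ℚ :=
      !![B e₁ (p e₁), B e₁ (q e₁), B e₁ (p (q e₁)); B e₂ (p e₂), B e₂ (q e₂), B e₂ (p (q e₂))]
    have hker : LinearMap.ker (Matrix.toLin' M) ≠ ⊥ := LinearMap.ker_ne_bot_of_finrank_lt (by simp)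
    obtain ⟨v, hv, hv0⟩ := Submodule.exists_mem_ne_zero_of_ne_bot hker
    rw [LinearMap.mem_ker, Matrix.toLin'_apply] at hv
    have hv1 : B e₁ (p e₁) * v 0 + B e₁ (q e₁) * v 1 + B e₁ (p (q e₁)) * v 2 = 0 := by
      simpa [M, Matrix.mulVec, dotProduct, Fin.sum_univ_three] using congrFun hv 0
    have hv2 : B e₂ (p e₂) * v 0 + B e₂ (q e₂) * v 1 + B e₂ (p (q e₂)) * v 2 = 0 := by
      simpa [M, Matrix.mulVec, dotProduct, Fin.sum_univ_three] using congrFun hv 1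
    obtain ⟨n, a, b, c, hn, ha, hb, hc⟩ := exists_int_mul_three (v 0) (v 1) (v 2)
    have habc : a ≠ 0 ∨ b ≠ 0 ∨ c ≠ 0 := by
      by_contra h0
      push Not at h0
      obtain ⟨rfl, rfl, rfl⟩ := h0
      have hn' : (n : ℚ) ≠ 0 := Nat.cast_ne_zero.2 hn.ne'
      apply hv0
      funext i
      fin_cases i <;> [simpa [hn'] using ha.symm; simpa [hn'] using hb.symm; simpa [hn'] using hc.symm]
    -- the pure element `θ = a p + b q + c pq` and its square `-N`
    set t : Module.End ℚ V := (a : ℚ) • p + (b : ℚ) • q + (c : ℚ) • (p * q) with ht_def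
    set N : ℚ := (a : ℚ) ^ 2 * d + (b : ℚ) ^ 2 * e + (c : ℚ) ^ 2 * (d * e) with hN_def
    have hN : 0 < N := by
      have hde : 0 < d * e := mul_pos hd he
      have ha2 := mul_nonneg (sq_nonneg (a : ℚ)) hd.le
      have hb2 := mul_nonneg (sq_nonneg (b : ℚ)) he.le
      have hc2 := mul_nonneg (sq_nonneg (c : ℚ)) hde.le
      rcases habc with h0 | h0 | h0
      · have : (0 : ℚ) < (a : ℚ) ^ 2 := by positivity
        nlinarith [mul_pos this hd]
      · have : (0 : ℚ) < (b : ℚ) ^ 2 := by positivity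
        nlinarith [mul_pos this he]
      · have : (0 : ℚ) < (c : ℚ) ^ 2 := by positivity
        nlinarith [mul_pos this hde]
    have ht_apply : ∀ x, t x = (a : ℚ) • p x + (b : ℚ) • q x + (c : ℚ) • p (q x) := fun x => by
      simp only [ht_def, LinearMap.add_apply, LinearMap.smul_apply, Module.End.mul_apply]
    have htt : ∀ x, t (t x) = -(N • x) := fun x => by
      rw [ht_apply, ht_apply]
      simp only [map_add, map_smul, hp, hq, hqp, map_neg, smul_neg, smul_add, smul_smul, hN_def]
      module
    have hBt : ∀ x y, B (t x) y = -B x (t y) := fun x y => by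
      rw [ht_apply, ht_apply]
      simp only [map_add, map_smul, LinearMap.add_apply, LinearMap.smul_apply, hBp x, hBq x, hBpq x, smul_eq_mul]
      ring
    have hWt : ∀ y ∈ W, t y ∈ W := fun y hy => by
      rw [ht_apply]
      exact W.add_mem (W.add_mem (W.smul_mem _ (hWp y hy)) (W.smul_mem _ (hWq y hy)))
        (W.smul_mem _ (hWp _ (hWq y hy)))
    have hA1 : B e₁ (t e₁) = 0 := by
      rw [ht_apply]
      simp only [map_add, map_smul, smul_eq_mul, ha, hb, hc]
      linear_combination (n : ℚ) * hv1
    have hA2 : B e₂ (t e₂) = 0 := by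
      rw [ht_apply]
      simp only [map_add, map_smul, smul_eq_mul, ha, hb, hc]
      linear_combination (n : ℚ) * hv2
    obtain ⟨w, hw, hws, hwB⟩ := caseB t B hN htt hBalt hBt W hWt hWe he₁W he₂W he₂ hA1 hA2
    exact ⟨a, b, c, habc, w, hw, hws, hwB⟩

end QuaternionFrame
/-! ## §5 In coordinates: matrices `P, R, G` on `ℚ^r` (the form consumed by the rational model of `H¹`) -/

open QuaternionFrame in
/-- **THE ISOTROPIC STABLE FRAME, in coordinates.** `4 < r`; `P² = -d`, `R² = -e`, `PR = -RP` in `Mat_r(ℚ)`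
(`d, e > 0`); `G` alternating (`G i k = -G k i`) with `Pᵀ G P = d G`, `Rᵀ G R = e G` (written as the double sums the
rational model of `Motives/RationalDegreeOneModelWeilType.gram_map_eq_mul_gram` produces). Then there are integers
`(a, b, c) ≠ 0` and `ℚ`-independent `w₀, …, w₃ ∈ ℚ^r` whose span is stable under `T = aP + bR + cPR` and which are
pairwise `G`-isotropic: `Σᵢⱼ w_k(i) G i j w_l(j) = 0` — the hypotheses `hb`, `hbM`, `hbG` of
`Motives.isHyperbolicWeilType_of_rationalModel`. [cite: vanGeemen1994HodgeAV, Lemma 5.2 (2)–(3) and 5.4] -/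
theorem exists_isotropic_stable_coords {r : ℕ} (hr : 4 < r) (P R G : Matrix (Fin r) (Fin r) ℚ) {d e : ℚ}
    (hd : 0 < d) (he : 0 < e) (hP : P * P = -(d • (1 : Matrix (Fin r) (Fin r) ℚ)))
    (hR : R * R = -(e • (1 : Matrix (Fin r) (Fin r) ℚ))) (hPR : P * R = -(R * P))
    (hG : ∀ i k, G i k = -G k i) (hPG : ∀ i k, ∑ a, ∑ b, P a i * G a b * P b k = d * G i k)
    (hRG : ∀ i k, ∑ a, ∑ b, R a i * G a b * R b k = e * G i k) :
    ∃ a b c : ℤ, (a ≠ 0 ∨ b ≠ 0 ∨ c ≠ 0) ∧ ∃ w : Fin 4 → (Fin r → ℚ), LinearIndependent ℚ w ∧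
      (∀ k, ∃ coef : Fin 4 → ℚ,
        ((a : ℚ) • P + (b : ℚ) • R + (c : ℚ) • (P * R)).mulVec (w k) = ∑ l, coef l • w l) ∧
      ∀ k l, ∑ i, ∑ j, w k i * G i j * w l j = 0 := by
  classical
  let p : Module.End ℚ (Fin r → ℚ) := Matrix.toLin' P
  let q : Module.End ℚ (Fin r → ℚ) := Matrix.toLin' R
  let B : LinearMap.BilinForm ℚ (Fin r → ℚ) := Matrix.toBilin' G
  have hp_apply : ∀ x, p x = P.mulVec x := fun x => Matrix.toLin'_apply P x
  have hq_apply : ∀ x, q x = R.mulVec x := fun x => Matrix.toLin'_apply R x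
  have hB_apply : ∀ x y, B x y = ∑ i, ∑ j, x i * G i j * y j := fun x y => Matrix.toBilin'_apply G x y
  have hp : ∀ x, p (p x) = -(d • x) := fun x => by
    rw [hp_apply, hp_apply, Matrix.mulVec_mulVec, hP, Matrix.neg_mulVec, Matrix.smul_mulVec, Matrix.one_mulVec]
  have hq : ∀ x, q (q x) = -(e • x) := fun x => by
    rw [hq_apply, hq_apply, Matrix.mulVec_mulVec, hR, Matrix.neg_mulVec, Matrix.smul_mulVec, Matrix.one_mulVec]
  have hqp : ∀ x, q (p x) = -(p (q x)) := fun x => by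
    rw [hq_apply, hp_apply, hp_apply, hq_apply, Matrix.mulVec_mulVec, Matrix.mulVec_mulVec, hPR, Matrix.neg_mulVec, neg_neg]
  -- the Gram form: alternating, `B(Px, Py) = d B(x, y)` hence `P` skew
  have hBalt : ∀ x, B x x = 0 := fun x => by
    rw [hB_apply]
    have h : ∑ i, ∑ j, x i * G i j * x j = -∑ i, ∑ j, x i * G i j * x j := by
      conv_rhs => rw [Finset.sum_comm]
      simp only [← Finset.sum_neg_distrib]
      exact Finset.sum_congr rfl fun i _ => Finset.sum_congr rfl fun j _ => by rw [hG i j]; ring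
    linarith
  have hcompat : ∀ (S : Matrix (Fin r) (Fin r) ℚ) (s : ℚ), (∀ i k, ∑ a, ∑ b, S a i * G a b * S b k = s * G i k) →
      ∀ x y, B (S.mulVec x) (S.mulVec y) = s * B x y := by
    intro S s hS x y
    -- both sides are bilinear in `(x, y)`: compare on the standard basis
    let B₁ : LinearMap.BilinForm ℚ (Fin r → ℚ) := B.compl₁₂ (Matrix.toLin' S) (Matrix.toLin' S)
    let B₂ : LinearMap.BilinForm ℚ (Fin r → ℚ) := s • B
    have hB12 : B₁ = B₂ := by
      refine LinearMap.ext_basis (Pi.basisFun ℚ (Fin r)) (Pi.basisFun ℚ (Fin r)) fun i k => ?_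
      simp only [B₁, B₂, LinearMap.compl₁₂_apply, LinearMap.smul_apply, Pi.basisFun_apply, Matrix.toLin'_apply,
        Matrix.mulVec_single_one, smul_eq_mul, B, Matrix.toBilin'_single]
      rw [Matrix.toBilin'_apply, ← hS i k]
      simp only [Matrix.col_apply]
    have h := congrArg (fun F : LinearMap.BilinForm ℚ (Fin r → ℚ) => F x y) hB12
    simpa only [B₁, B₂, LinearMap.compl₁₂_apply, LinearMap.smul_apply, Matrix.toLin'_apply, smul_eq_mul] using h
  have hskew : ∀ (S : Matrix (Fin r) (Fin r) ℚ) (s : ℚ), s ≠ 0 → S * S = -(s • (1 : Matrix (Fin r) (Fin r) ℚ)) →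
      (∀ x y, B (S.mulVec x) (S.mulVec y) = s * B x y) → ∀ x y, B (S.mulVec x) y = -B x (S.mulVec y) := by
    intro S s hs hSS hc x y
    have h1 := hc x (S.mulVec y)
    rw [Matrix.mulVec_mulVec, hSS, Matrix.neg_mulVec, Matrix.smul_mulVec, Matrix.one_mulVec, map_neg,
      map_smul, smul_eq_mul] at h1
    have h2 : s * (B (S.mulVec x) y + B x (S.mulVec y)) = 0 := by linear_combination -h1
    linear_combination (mul_eq_zero.1 h2).resolve_left hs
  have hBp : ∀ x y, B (p x) y = -B x (p y) := fun x y => by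
    rw [hp_apply, hp_apply]; exact hskew P d hd.ne' hP (hcompat P d hPG) x y
  have hBq : ∀ x y, B (q x) y = -B x (q y) := fun x y => by
    rw [hq_apply, hq_apply]; exact hskew R e he.ne' hR (hcompat R e hRG) x y
  have hV : 4 < Module.finrank ℚ (Fin r → ℚ) := by simpa using hr
  obtain ⟨a, b, c, habc, w, hw, hws, hwB⟩ := exists_isotropic_stable_frame hV p q B hd he hp hq hqp hBalt hBp hBq
  refine ⟨a, b, c, habc, w, hw, fun k => ?_, fun k l => by rw [← hB_apply]; exact hwB k l⟩
  obtain ⟨coef, hcoef⟩ := hws k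
  refine ⟨coef, hcoef ▸ ?_⟩
  simp only [LinearMap.add_apply, LinearMap.smul_apply, Module.End.mul_apply, hp_apply, hq_apply, Matrix.add_mulVec,
    Matrix.smul_mulVec, Matrix.mulVec_mulVec]

end Summit.HodgeConjecture.HodgeConjecture.Ring2.AbelianAll

end
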